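import Mathlib.Topology.Homotopy.Lifting
import Mathlib.Analysis.Convex.Contractible
import Mathlib.AlgebraicTopology.FundamentalGroupoid.SimplyConnected
import Literature.AlgebraicGeometry.ShimuraVarieties.UnitaryBallQuotientSurface
import Literature.AlgebraicTopology.FundamentalGroup.CompactManifoldFundamentalGroupFG
import HarnessLib

/-!
# The uniformisation of a compact ball quotient is a universal covering; `Γ ≅ π₁` is finitely generated

Layer `Literature/AlgebraicGeometry/ShimuraVarieties`, sequel of `UnitaryBallQuotientSurface` (the compact
complex surface `S(Γ) = Δ \ 𝔹²`, `Δ = ρ_𝔣(Γ) = D.ballImage 𝔣 ≤ U(2,1)` acting freely and properly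
discontinuously on the ball, and the homeomorphism `S(Γ) ≃ₜ X(ℂ)`).  THEOREMS ONLY (no definition, no named
fact), junction of Mathlib's covering-space theory (`IsQuotientCoveringMap`, J. Xu) with the tree:

* `BallModel.contractibleSpace_ball`, `BallModel.simplyConnectedSpace_ball` — the ball `𝔹² ⊂ ℂ²` is
  star-shaped, hence contractible and simply connected;
* `isQuotientCoveringMap_quotientSurfaceMk` — **`𝔹² → Δ \ 𝔹²` is a quotient covering map** for the free,
  properly discontinuous action of `Δ` (Mathlib `isQuotientCoveringMap_quotientMk_of_properlyDiscontinuousSMul`;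
  Hatcher Prop. 1.40), and `isQuotientCoveringMap_ballUnifMap` — so is the uniformisation
  `ballUnifMap : 𝔹² → X(ℂ)` of the datum (composition with the homeomorphism `S(Γ) ≃ₜ X(ℂ)`); in particular
  both are covering maps (`isCoveringMap_ballUnifMap`);
* `nonempty_fundamentalGroup_mulEquiv_ballImage` / `…_complexPoints` — **`π₁(S(Γ)) ≅ Δᵐᵒᵖ`**,
  **`π₁(X(ℂ)) ≅ Δᵐᵒᵖ ≅ Γᵐᵒᵖ`** (the deck group of the universal covering `𝔹²`; Mathlib
  `IsQuotientCoveringMap.fundamentalGroupEquiv`, Hatcher Prop. 1.39/1.40);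
* `nonempty_mulEquiv_ballImage` — `Γ ≅ Δ` (`ρ_𝔣` is injective, `ballRep_injective`);
* **`fg_ballImage`, `fg_Γ`** — `Δ` and `Γ` are FINITELY GENERATED: `π₁` of the compact manifold `S(Γ)` is
  finitely generated (the tree's `fundamentalGroup_fg_of_compactSpace_chartedSpace`, Hatcher proof of Thm. 1.20)
  and `Γ ≅ Δ ≅ π₁(S(Γ))ᵒᵖ`.

Use (cell `pub-hodgecm2`, plan ALB-H1-ISO step S3b): the period group of the holomorphic `1`-forms of
`X = Γ \ 𝔹²` is the image of `Γ`, hence finitely generated; with `Hom(Γ, ℚ) ≅ H¹(X(ℂ); ℚ)` this bounds its rank.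

## References

* [HatcherAT2002] A. Hatcher, *Algebraic Topology* (2002), §1.3 Prop. 1.39, Prop. 1.40, proof of Thm. 1.20.
* [BergeronMillsonMoeglin2016Balls] N. Bergeron, J. Millson, C. Moeglin, Acta Math. 216 (2016),
  Introduction §1.1 (`S(Γ) = Γ \ 𝔹ⁿ` for cocompact torsion-free `Γ`).
* [Borel1969] A. Borel, *Introduction aux groupes arithmétiques* (1969), Prop. 7.13.
-/

noncomputable section

open MulAction Function Topology
open Literature.Geometry.ComplexHyperbolic
open Literature.Geometry.ComplexHyperbolic.BallModel (U21 Ball x₀ nsq)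

namespace Literature.Geometry.ComplexHyperbolic.BallModel

/-- **The ball is contractible**: `𝔹² = {z ∈ ℂ² : |z₀|² + |z₁|² < 1}` is star-shaped at `0`.
[cite: HatcherAT2002, §1.3 (the universal cover of `Γ \ 𝔹`)] -/
theorem contractibleSpace_ball : ContractibleSpace Ball := by
  have h : StarConvex ℝ (0 : Fin 2 → ℂ) {w : Fin 2 → ℂ | nsq w < 1} := by
    rw [starConvex_zero_iff]
    intro x hx a ha0 ha1
    change nsq (a • x) < 1
    have hx' : nsq x < 1 := hx
    simp only [BallModel.nsq] at hx' ⊢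
    have h0 : ‖(a • x) 0‖ = a * ‖x 0‖ := by rw [Pi.smul_apply, norm_smul, Real.norm_of_nonneg ha0]
    have h1 : ‖(a • x) 1‖ = a * ‖x 1‖ := by rw [Pi.smul_apply, norm_smul, Real.norm_of_nonneg ha0]
    rw [h0, h1]
    have ha2 : a ^ 2 ≤ 1 := by nlinarith
    nlinarith [sq_nonneg ‖x 0‖, sq_nonneg ‖x 1‖, sq_nonneg a]
  have hne : ({w : Fin 2 → ℂ | nsq w < 1} : Set (Fin 2 → ℂ)).Nonempty := ⟨0, by simp [BallModel.nsq]⟩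
  exact h.contractibleSpace hne

/-- **The ball is simply connected.** [cite: HatcherAT2002, §1.3 (the universal cover of `Γ \ 𝔹`)] -/
theorem simplyConnectedSpace_ball : SimplyConnectedSpace Ball := by
  haveI := contractibleSpace_ball
  infer_instance

end Literature.Geometry.ComplexHyperbolic.BallModel

namespace Literature.AlgebraicGeometry.ShimuraVarieties

namespace UnitaryBallUniformisationDatum

variable {X : Motives.SchemeOver ℂ} (D : UnitaryBallUniformisationDatum 2 X) (𝔣 : D.SylvesterFrame)

/-! ### The quotient covering maps `𝔹² → S(Γ)` and `𝔹² → X(ℂ)` -/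

/-- **`𝔹² → Δ \ 𝔹² = S(Γ)` is a quotient covering map** for the free (`instIsCancelSMulBallImage`), properly
discontinuous (`instProperlyDiscontinuousSMulBallImage`) action of `Δ = ρ_𝔣(Γ)` on the locally compact
Hausdorff ball. [cite: HatcherAT2002, §1.3 Prop. 1.40] -/
theorem isQuotientCoveringMap_quotientSurfaceMk :
    IsQuotientCoveringMap (D.quotientSurfaceMk 𝔣) (D.ballImage 𝔣) :=
  isQuotientCoveringMap_quotientMk_of_properlyDiscontinuousSMul

/-- **The uniformisation `ballUnifMap : 𝔹² → X(ℂ)` is a quotient covering map** for the action of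
`Δ = ρ_𝔣(Γ)` (`quotientSurfaceHomeomorph ∘ mk = ballUnifMap`). [cite: HatcherAT2002, §1.3 Prop. 1.40]
[cite: BergeronMillsonMoeglin2016Balls, Introduction §1.1] -/
theorem isQuotientCoveringMap_ballUnifMap :
    IsQuotientCoveringMap (D.ballUnifMap 𝔣) (D.ballImage 𝔣) := by
  have h := (D.isQuotientCoveringMap_quotientSurfaceMk 𝔣).homeomorph_comp (D.quotientSurfaceHomeomorph 𝔣)
  exact h

/-- The uniformisation `𝔹² → X(ℂ)` is a covering map. [cite: HatcherAT2002, §1.3 Prop. 1.40] -/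
theorem isCoveringMap_ballUnifMap : IsCoveringMap (D.ballUnifMap 𝔣) :=
  (D.isQuotientCoveringMap_ballUnifMap 𝔣).isCoveringMap

/-- The projection `𝔹² → S(Γ)` is a covering map. [cite: HatcherAT2002, §1.3 Prop. 1.40] -/
theorem isCoveringMap_quotientSurfaceMk : IsCoveringMap (D.quotientSurfaceMk 𝔣) :=
  (D.isQuotientCoveringMap_quotientSurfaceMk 𝔣).isCoveringMap

/-! ### `π₁ ≅ Δᵐᵒᵖ ≅ Γᵐᵒᵖ` -/

/-- **`π₁(S(Γ), [z]) ≅ Δᵐᵒᵖ`**: the fundamental group of the quotient surface at the image of any ball point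
is anti-isomorphic to the deck group `Δ = ρ_𝔣(Γ)` of its simply connected covering `𝔹²`.
[cite: HatcherAT2002, §1.3 Prop. 1.39 and Prop. 1.40] -/
theorem nonempty_fundamentalGroup_mulEquiv_ballImage (z : Ball) :
    Nonempty (FundamentalGroup (D.quotientSurface 𝔣) (D.quotientSurfaceMk 𝔣 z) ≃* (D.ballImage 𝔣)ᵐᵒᵖ) := by
  haveI := BallModel.simplyConnectedSpace_ball
  exact ⟨(D.isQuotientCoveringMap_quotientSurfaceMk 𝔣).fundamentalGroupEquiv ⟨z, rfl⟩⟩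

/-- **`π₁(X(ℂ), ψ z) ≅ Δᵐᵒᵖ`** for the uniformisation `ψ = ballUnifMap` of the datum.
[cite: HatcherAT2002, §1.3 Prop. 1.39 and Prop. 1.40] [cite: BergeronMillsonMoeglin2016Balls, Introduction §1.1] -/
theorem nonempty_fundamentalGroup_complexPoints_mulEquiv_ballImage (z : Ball) :
    Nonempty (FundamentalGroup (Motives.ComplexPoints X) (D.ballUnifMap 𝔣 z) ≃* (D.ballImage 𝔣)ᵐᵒᵖ) := by
  haveI := BallModel.simplyConnectedSpace_ball
  exact ⟨(D.isQuotientCoveringMap_ballUnifMap 𝔣).fundamentalGroupEquiv ⟨z, rfl⟩⟩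

/-- **`Γ ≅ Δ = ρ_𝔣(Γ)`**: the ball representation is injective (`ballRep_injective`) with image `ballImage`.
[cite: BergeronMillsonMoeglin2016Balls, Introduction §1.1] -/
theorem nonempty_mulEquiv_ballImage : Nonempty (D.Γ ≃* D.ballImage 𝔣) :=
  ⟨(MonoidHom.ofInjective (D.ballRep_injective 𝔣)).trans
    (MulEquiv.subgroupCongr (MonoidHom.range_eq_map (D.ballRep 𝔣)))⟩

/-- **`π₁(X(ℂ), ψ z) ≅ Γᵐᵒᵖ`.** [cite: HatcherAT2002, §1.3 Prop. 1.39 and Prop. 1.40]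
[cite: BergeronMillsonMoeglin2016Balls, Introduction §1.1] -/
theorem nonempty_fundamentalGroup_complexPoints_mulEquiv (z : Ball) :
    Nonempty (FundamentalGroup (Motives.ComplexPoints X) (D.ballUnifMap 𝔣 z) ≃* (D.Γ)ᵐᵒᵖ) := by
  obtain ⟨e₁⟩ := D.nonempty_fundamentalGroup_complexPoints_mulEquiv_ballImage 𝔣 z
  obtain ⟨e₂⟩ := D.nonempty_mulEquiv_ballImage 𝔣
  exact ⟨e₁.trans (MulEquiv.op e₂).symm⟩

/-! ### Finite generation -/

/-- **`π₁(S(Γ))` is finitely generated** (`S(Γ)` is a compact Hausdorff manifold charted on `ℂ²`).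
[cite: HatcherAT2002, Lemma 1.15 and proof of Thm. 1.20] -/
theorem fg_fundamentalGroup_quotientSurface (p : D.quotientSurface 𝔣) :
    Group.FG (FundamentalGroup (D.quotientSurface 𝔣) p) :=
  Literature.AlgebraicTopology.FundamentalGroup.fundamentalGroup_fg_of_compactSpace_chartedSpace
    (E := Fin 2 → ℂ) p

/-- **`Δ = ρ_𝔣(Γ)` is finitely generated** (`Δᵐᵒᵖ ≅ π₁(S(Γ))`). [cite: HatcherAT2002, §1.3 Prop. 1.40 and proof of Thm. 1.20] -/
theorem fg_ballImage : Group.FG (D.ballImage 𝔣) := by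
  obtain ⟨e⟩ := D.nonempty_fundamentalGroup_mulEquiv_ballImage 𝔣 x₀
  haveI := D.fg_fundamentalGroup_quotientSurface 𝔣 (D.quotientSurfaceMk 𝔣 x₀)
  haveI : Group.FG (D.ballImage 𝔣)ᵐᵒᵖ := Group.fg_of_surjective (f := e.toMonoidHom) e.surjective
  exact Group.fg_of_surjective (f := (MulEquiv.inv' (D.ballImage 𝔣)).symm.toMonoidHom)
    (MulEquiv.inv' (D.ballImage 𝔣)).symm.surjective

/-- **`Γ` is finitely generated** (`Γ ≅ Δ`). [cite: HatcherAT2002, §1.3 Prop. 1.40 and proof of Thm. 1.20]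
[cite: BergeronMillsonMoeglin2016Balls, Introduction §1.1] -/
theorem fg_Γ : Group.FG D.Γ := by
  obtain ⟨𝔣⟩ := D.nonempty_sylvesterFrame
  obtain ⟨e⟩ := D.nonempty_mulEquiv_ballImage 𝔣
  haveI := D.fg_ballImage 𝔣
  exact Group.fg_of_surjective (f := e.symm.toMonoidHom) e.symm.surjective

end UnitaryBallUniformisationDatum

end Literature.AlgebraicGeometry.ShimuraVarieties

end
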